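import Literature.NumberTheory.Transcendental.KZLogCalculusProofs
import Literature.NumberTheory.Transcendental.KZSemialgebraicComplex
import Literature.ModelTheory.ExponentialFields.SemialgebraicComponents
import Summits.KontsevichZagierPeriods.KontsevichZagierPeriods.Theorems.LiouvilleUnfoldingLogPrimitiveNLStubDescentCells

/-!
# `LogPrimitiveNL` (stmt-KontsevichZagierPeriods-2836), line `logderiv-peeling`, stub `stub_descent` —
part 3: bookkeeping of the induction step (refinement of cell families, reindexing, one piece)

Lead's stub, Kolchin–Ostrowski descent. This file: (i) common refinement of finitely many almost-
partitions of an open set `A` by open `ℚ`-semialgebraic cells; (ii) reindexing of finite families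
(cells, lattice vectors) by `Fin N`; (iii) the conclusion on ONE piece of the induction step: from the
integrate-back normal form `h_i/h_k = v_i + Σ_t q_t f_t i` (`v` algebraic constants, `∏ W^{f_t} ≡ 1`)
and constant-coefficient rigidity, the structure `g ≡ 0`, `h = Σ_r Q_r F_r` with `∏ W^{F_r} ≡ 1`.
-/

noncomputable section

open Set MeasureTheory
open scoped ContDiff
open Literature.NumberTheory.Transcendental Literature.ModelTheory.ExponentialFields

namespace Summit.KontsevichZagierPeriods.LiouvilleUnfolding.LogPrimitiveNL

/-! ### Finite intersections and common refinements -/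

/-- A finite (`Fin n`-indexed) intersection of `ℚ`-semialgebraic sets, cut with a `ℚ`-semialgebraic
set, is `ℚ`-semialgebraic. [folklore] -/
theorem descent_isSemialgebraic_inter_iInter {n m : ℕ} {A : Set (Fin m → ℝ)}
    (hA : IsSemialgebraic ℚ A) {S : Fin n → Set (Fin m → ℝ)} (hS : ∀ j, IsSemialgebraic ℚ (S j)) :
    IsSemialgebraic ℚ (A ∩ ⋂ j, S j) := by
  have : (⋂ j, S j) = ⋂ j ∈ (Finset.univ : Finset (Fin n)), S j := by simp
  rw [this]
  exact hA.inter (IsSemialgebraic.biInter _ _ fun j _ => hS j)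

/-- **Common refinement.** Given, for each direction `j`, an almost-partition of the open set `A`
into open `ℚ`-semialgebraic cells `C j c ⊆ A` (pairwise disjoint, null complement in `A`), the cells
`A ∩ ⋂ⱼ C j (κ j)` indexed by choice functions `κ` form again such an almost-partition, refining every
one of the given ones. [folklore] -/
theorem descent_refine {n : ℕ} {A : Set (Fin n → ℝ)} (hA : IsSemialgebraic ℚ A) (hAo : IsOpen A)
    {N : Fin n → ℕ} (C : (j : Fin n) → Fin (N j) → Set (Fin n → ℝ))
    (hC : ∀ j c, IsSemialgebraic ℚ (C j c) ∧ IsOpen (C j c) ∧ C j c ⊆ A)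
    (hdisj : ∀ j, Pairwise (Function.onFun Disjoint (C j)))
    (hnull : ∀ j, volume (A \ ⋃ c, C j c) = 0) :
    (∀ κ : (j : Fin n) → Fin (N j), IsSemialgebraic ℚ (A ∩ ⋂ j, C j (κ j)) ∧
      IsOpen (A ∩ ⋂ j, C j (κ j)) ∧ (A ∩ ⋂ j, C j (κ j)) ⊆ A ∧
      ∀ j, (A ∩ ⋂ j', C j' (κ j')) ⊆ C j (κ j)) ∧
    Pairwise (Function.onFun Disjoint (fun κ : (j : Fin n) → Fin (N j) => A ∩ ⋂ j, C j (κ j))) ∧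
    volume (A \ ⋃ κ : (j : Fin n) → Fin (N j), (A ∩ ⋂ j, C j (κ j))) = 0 := by
  refine ⟨fun κ => ⟨descent_isSemialgebraic_inter_iInter hA fun j => (hC j (κ j)).1,
    hAo.inter (isOpen_iInter_of_finite fun j => (hC j (κ j)).2.1), inter_subset_left,
    fun j x hx => mem_iInter.1 hx.2 j⟩, ?_, ?_⟩
  · intro κ κ' hκ
    obtain ⟨j, hj⟩ := Function.ne_iff.1 hκ
    rw [Function.onFun, Set.disjoint_iff]
    rintro x ⟨hx, hx'⟩
    exact (Set.disjoint_iff.1 (hdisj j hj)) ⟨mem_iInter.1 hx.2 j, mem_iInter.1 hx'.2 j⟩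
  · refine measure_mono_null (fun x hx => ?_) (measure_iUnion_null_iff.2 hnull)
    rw [mem_iUnion]
    by_contra hcon
    push Not at hcon
    have hall : ∀ j, ∃ c, x ∈ C j c := fun j => by
      have := hcon j
      rw [mem_sdiff, not_and, not_not] at this
      exact mem_iUnion.1 (this hx.1)
    choose κ hκ using hall
    exact hx.2 (mem_iUnion.2 ⟨κ, hx.1, mem_iInter.2 hκ⟩)

/-! ### Reindexing by `Fin` -/

/-- Reindexing the lattice data of a cell by `Fin R`. [folklore] -/
theorem descent_struct_of_fintype {n k : ℕ} {C : Set (Fin n → ℝ)}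
    {h W : Fin k → (Fin n → ℝ) → ℝ} {S : Type*} [Fintype S] (F : S → Fin k → ℤ)
    (Q : S → (Fin n → ℝ) → ℝ) (hQ : ∀ s, IsSemialgebraicFunOn ℚ C (Q s))
    (hF : ∀ s, ∀ x ∈ C, ∏ i, W i x ^ (F s i) = 1)
    (hh : ∀ i, ∀ x ∈ C, h i x = ∑ s, Q s x * (F s i : ℝ)) :
    ∃ (R : ℕ) (f : Fin R → Fin (k) → ℤ) (q : Fin R → (Fin n → ℝ) → ℝ),
            (∀ r, IsSemialgebraicFunOn ℚ (C) (q r)) ∧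
            (∀ r, ∀ x ∈ C, ∏ i, W i x ^ (f r i) = 1) ∧
            (∀ i, ∀ x ∈ C, h i x = ∑ r, q r x * (f r i : ℝ)) := by
  refine ⟨Fintype.card S, fun r => F ((Fintype.equivFin S).symm r),
    fun r => Q ((Fintype.equivFin S).symm r), fun r => hQ _, fun r => hF _, fun i x hx => ?_⟩
  rw [hh i x hx]
  exact ((Fintype.equivFin S).symm.sum_comp (fun s => Q s x * (F s i : ℝ))).symm

/-- Reindexing a finite family of cells (with their conclusions) by `Fin N`. [folklore] -/
theorem descent_concl_of_family {n k : ℕ} {U : Set (Fin n → ℝ)}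
    {h W : Fin k → (Fin n → ℝ) → ℝ} {g : (Fin n → ℝ) → ℝ} {J : Type*} [Fintype J]
    (C : J → Set (Fin n → ℝ)) (hC : ∀ c, IsSemialgebraic ℚ (C c) ∧ IsOpen (C c) ∧ C c ⊆ U)
    (hdisj : Pairwise (Function.onFun Disjoint C)) (hnull : volume (U \ ⋃ c, C c) = 0)
    (hcell : ∀ c, (∀ x ∈ C c, g x = 0) ∧
      ∃ (R : ℕ) (f : Fin R → Fin (k) → ℤ) (q : Fin R → (Fin n → ℝ) → ℝ),
            (∀ r, IsSemialgebraicFunOn ℚ (C c) (q r)) ∧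
            (∀ r, ∀ x ∈ C c, ∏ i, W i x ^ (f r i) = 1) ∧
            (∀ i, ∀ x ∈ C c, h i x = ∑ r, q r x * (f r i : ℝ))) :
    ∃ (N : ℕ) (C : Fin N → Set (Fin n → ℝ)),
        (∀ c, IsSemialgebraic ℚ (C c) ∧ IsOpen (C c) ∧ C c ⊆ U) ∧
        Pairwise (Function.onFun Disjoint C) ∧ volume (U \ ⋃ c, C c) = 0 ∧
        ∀ c, (∀ x ∈ C c, g x = 0) ∧
          ∃ (R : ℕ) (f : Fin R → Fin (k) → ℤ) (q : Fin R → (Fin n → ℝ) → ℝ),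
            (∀ r, IsSemialgebraicFunOn ℚ (C c) (q r)) ∧
            (∀ r, ∀ x ∈ C c, ∏ i, W i x ^ (f r i) = 1) ∧
            (∀ i, ∀ x ∈ C c, h i x = ∑ r, q r x * (f r i : ℝ)) := by
  obtain ⟨N, e, hunion, hd⟩ := descent_reindex_fin C
  exact ⟨N, fun c => C (e.symm c), fun c => hC _, hd hdisj, by rw [hunion]; exact hnull,
    fun c => hcell _⟩

/-! ### One piece of the induction step -/

/-- `Σᵢ fᵢ log wᵢ = log ∏ᵢ wᵢ^{fᵢ}` for positive reals. [folklore] -/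
theorem descent_sum_int_mul_log {k : ℕ} (f : Fin k → ℤ) (w : Fin k → ℝ) (hw : ∀ i, 0 < w i) :
    ∑ i, (f i : ℝ) * Real.log (w i) = Real.log (∏ i, w i ^ (f i)) := by
  rw [Real.log_prod]
  · exact Finset.sum_congr rfl fun i _ => (Real.log_zpow (w i) (f i)).symm
  · intro i _
    exact zpow_ne_zero _ (hw i).ne'

/-- **Structure on one piece** of the induction step of the descent. On an open `ℚ`-semialgebraic
piece `E` where the pivot `h_k` does not vanish, suppose `Σ_{i ≤ k} hᵢ log Wᵢ = g`, the normalised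
coefficients have the integrate-back normal form `hᵢ/h_k = vᵢ + Σ_t q_t f_t i` (`i < k`) with `vᵢ`
ALGEBRAIC constants, `q_t` `ℚ`-semialgebraic and exact relations `∏_{i<k} Wᵢ^{f_t i} ≡ 1` on `E`.
Then the identity collapses to `Σ_{i<k} vᵢ log Wᵢ + log W_k = g/h_k` with constant algebraic
coefficients, constant-coefficient rigidity gives `g ≡ 0` and `(v, 1) = Σ_r β_r F_r` with
`∏_{i ≤ k} Wᵢ^{F_r i} ≡ 1`, and `h = h_k · ((v,1) + (Σ_t q_t f_t, 0))` is the required lattice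
decomposition of `h` on `E`. [folklore] -/
theorem descent_piece {n k : ℕ} (hConst : (∀ (n k : ℕ) (D : Set (Fin n → ℝ)) (c : Fin k → ℝ) (W : Fin k → (Fin n → ℝ) → ℝ)
      (G : (Fin n → ℝ) → ℝ), IsSemialgebraic ℚ D → IsOpen D → (∀ i, IsAlgebraic ℚ (c i)) →
      (∀ i, IsSemialgebraicFunOn ℚ D (W i)) → (∀ i, ContinuousOn (W i) D) →
      (∀ i, ∀ x ∈ D, 0 < W i x) → IsSemialgebraicFunOn ℚ D G → ContinuousOn G D →
      (∀ x ∈ D, ∑ i, c i * Real.log (W i x) = G x) →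
      (∀ x ∈ D, G x = 0) ∧ ∃ (R : ℕ) (f : Fin R → Fin k → ℤ) (β : Fin R → ℝ),
        (∀ r, IsAlgebraic ℚ (β r)) ∧ (∀ r, ∀ x ∈ D, ∏ i, W i x ^ (f r i) = 1) ∧
        (∀ i, c i = ∑ r, β r * (f r i : ℝ))))
    {E : Set (Fin n → ℝ)} (hE : IsSemialgebraic ℚ E) (hEo : IsOpen E)
    {h W : Fin (k + 1) → (Fin n → ℝ) → ℝ} {g : (Fin n → ℝ) → ℝ}
    (hW : ∀ i, IsSemialgebraicFunOn ℚ E (W i)) (hWc : ∀ i, ContinuousOn (W i) E)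
    (hWpos : ∀ i, ∀ x ∈ E, 0 < W i x) (hhl : IsSemialgebraicFunOn ℚ E (h (Fin.last k)))
    (hγ : IsSemialgebraicFunOn ℚ E (fun x => g x / h (Fin.last k) x))
    (hγc : ContinuousOn (fun x => g x / h (Fin.last k) x) E)
    (hpiv : ∀ x ∈ E, h (Fin.last k) x ≠ 0)
    (hrel : ∀ x ∈ E, ∑ i, h i x * Real.log (W i x) = g x)
    {T : Type*} [Fintype T] (fvec : T → Fin k → ℤ) (v : Fin k → ℝ) (q : T → (Fin n → ℝ) → ℝ)
    (hv : ∀ i, IsAlgebraic ℚ (v i)) (hq : ∀ t, IsSemialgebraicFunOn ℚ E (q t))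
    (hφ : ∀ i, ∀ x ∈ E, h (Fin.castSucc i) x / h (Fin.last k) x = v i + ∑ t, q t x * (fvec t i : ℝ))
    (hfW : ∀ t, ∀ x ∈ E, ∏ i : Fin k, W (Fin.castSucc i) x ^ (fvec t i) = 1) :
    (∀ x ∈ E, g x = 0) ∧ ∃ (R : ℕ) (f : Fin R → Fin (k + 1) → ℤ) (q : Fin R → (Fin n → ℝ) → ℝ),
            (∀ r, IsSemialgebraicFunOn ℚ (E) (q r)) ∧
            (∀ r, ∀ x ∈ E, ∏ i, W i x ^ (f r i) = 1) ∧
            (∀ i, ∀ x ∈ E, h i x = ∑ r, q r x * (f r i : ℝ)) := by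
  classical
  set hl : (Fin n → ℝ) → ℝ := h (Fin.last k) with hhl_def
  set c : Fin (k + 1) → ℝ := Fin.snoc v 1 with hc_def
  have hc_alg : ∀ i, IsAlgebraic ℚ (c i) := by
    refine Fin.lastCases ?_ (fun i => ?_)
    · simp only [hc_def, Fin.snoc_last]
      exact isAlgebraic_one
    · simp only [hc_def, Fin.snoc_castSucc]
      exact hv i
  -- the `q`-part of the normal form contributes nothing to the logarithmic identity
  have hψ : ∀ x ∈ E, ∑ i : Fin k, (∑ t, q t x * (fvec t i : ℝ)) * Real.log (W (Fin.castSucc i) x) = 0 := by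
    intro x hx
    have : ∀ t, ∑ i : Fin k, (fvec t i : ℝ) * Real.log (W (Fin.castSucc i) x) = 0 := fun t => by
      rw [descent_sum_int_mul_log (fvec t) (fun i => W (Fin.castSucc i) x) fun i => hWpos _ x hx,
        hfW t x hx, Real.log_one]
    calc ∑ i : Fin k, (∑ t, q t x * (fvec t i : ℝ)) * Real.log (W (Fin.castSucc i) x)
        = ∑ t, q t x * ∑ i : Fin k, (fvec t i : ℝ) * Real.log (W (Fin.castSucc i) x) := by
          simp only [Finset.sum_mul, Finset.mul_sum]
          rw [Finset.sum_comm]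
          exact Finset.sum_congr rfl fun t _ => Finset.sum_congr rfl fun i _ => by ring
      _ = 0 := Finset.sum_eq_zero fun t _ => by rw [this t, mul_zero]
  -- the collapsed identity with constant algebraic coefficients
  have hrel' : ∀ x ∈ E, ∑ i, c i * Real.log (W i x) = g x / hl x := by
    intro x hx
    have hx0 : hl x ≠ 0 := hpiv x hx
    have h1 : ∑ i, h i x * Real.log (W i x) =
        (∑ i : Fin k, h (Fin.castSucc i) x * Real.log (W (Fin.castSucc i) x)) +
          hl x * Real.log (W (Fin.last k) x) := Fin.sum_univ_castSucc _
    have hhi : ∀ i : Fin k, h (Fin.castSucc i) x = hl x * (v i + ∑ t, q t x * (fvec t i : ℝ)) :=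
      fun i => by
        have := hφ i x hx
        rw [div_eq_iff hx0] at this
        rw [this, mul_comm]
    have h2 : ∑ i : Fin k, h (Fin.castSucc i) x * Real.log (W (Fin.castSucc i) x) =
        hl x * ∑ i : Fin k, v i * Real.log (W (Fin.castSucc i) x) := by
      calc ∑ i : Fin k, h (Fin.castSucc i) x * Real.log (W (Fin.castSucc i) x)
          = hl x * ∑ i : Fin k, v i * Real.log (W (Fin.castSucc i) x) +
              hl x * ∑ i : Fin k, (∑ t, q t x * (fvec t i : ℝ)) *
                Real.log (W (Fin.castSucc i) x) := by
            rw [Finset.mul_sum, Finset.mul_sum, ← Finset.sum_add_distrib]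
            exact Finset.sum_congr rfl fun i _ => by rw [hhi i]; ring
        _ = hl x * ∑ i : Fin k, v i * Real.log (W (Fin.castSucc i) x) := by
            rw [hψ x hx, mul_zero, add_zero]
    rw [Fin.sum_univ_castSucc]
    simp only [hc_def, Fin.snoc_castSucc, Fin.snoc_last, one_mul]
    rw [eq_div_iff hx0, add_mul, Finset.sum_mul, ← hrel x hx, h1, h2, Finset.mul_sum]
    congr 1
    · exact Finset.sum_congr rfl fun i _ => by ring
    · ring
  -- constant-coefficient rigidity
  obtain ⟨hG0, R₂, f₂, β, hβ, hf₂W, hcβ⟩ := hConst n (k + 1) E c W (fun x => g x / hl x) hE hEo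
    hc_alg hW hWc hWpos hγ hγc hrel'
  refine ⟨fun x hx => ?_, ?_⟩
  · have := hG0 x hx
    rw [div_eq_zero_iff] at this
    exact this.resolve_right (hpiv x hx)
  -- the lattice decomposition of `h` on `E`, indexed by `Fin R₂ ⊕ T`
  refine descent_struct_of_fintype (S := Fin R₂ ⊕ T)
    (Sum.elim f₂ fun t => Fin.snoc (fvec t) 0)
    (Sum.elim (fun r x => hl x * β r) fun t x => hl x * q t x) ?_ ?_ ?_
  · rintro (r | t)
    · exact IsSemialgebraicFunOn.mul_holds hhl (isSemialgebraicFunOn_const_of_isAlgebraic hE (hβ r))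
    · exact IsSemialgebraicFunOn.mul_holds hhl (hq t)
  · rintro (r | t) x hx
    · exact hf₂W r x hx
    · simp only [Sum.elim_inr]
      rw [Fin.prod_univ_castSucc]
      simp only [Fin.snoc_castSucc, Fin.snoc_last, zpow_zero, mul_one]
      exact hfW t x hx
  · intro i x hx
    have hx0 : hl x ≠ 0 := hpiv x hx
    rw [Fintype.sum_sum_type]
    simp only [Sum.elim_inl, Sum.elim_inr]
    have hci : ∑ r, hl x * β r * (f₂ r i : ℝ) = hl x * c i := by
      rw [hcβ i, Finset.mul_sum]
      exact Finset.sum_congr rfl fun r _ => by ring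
    rw [hci]
    induction i using Fin.lastCases with
    | last =>
      simp only [hc_def, Fin.snoc_last, Int.cast_zero, mul_zero, Finset.sum_const_zero, add_zero,
        mul_one]
      rfl
    | cast i =>
      simp only [hc_def, Fin.snoc_castSucc]
      have hhi : h (Fin.castSucc i) x = hl x * (v i + ∑ t, q t x * (fvec t i : ℝ)) := by
        have := hφ i x hx
        rw [div_eq_iff hx0] at this
        rw [this, mul_comm]
      rw [hhi, mul_add, Finset.mul_sum]
      congr 1
      exact Finset.sum_congr rfl fun t _ => by ring

/-! ### Step B: the pivot vanishes identically -/

/-- **Step B of the descent.** Where the pivot `h_k` vanishes identically the identity involves only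
`k` logarithms; the lattice vectors of the induction hypothesis extend by `0`. [folklore] -/
theorem descent_stepB {n k : ℕ} {B : Set (Fin n → ℝ)} {h W : Fin (k + 1) → (Fin n → ℝ) → ℝ}
    {g : (Fin n → ℝ) → ℝ} (h0 : ∀ x ∈ B, h (Fin.last k) x = 0)
    (hc : ∃ (N : ℕ) (C : Fin N → Set (Fin n → ℝ)),
        (∀ c, IsSemialgebraic ℚ (C c) ∧ IsOpen (C c) ∧ C c ⊆ B) ∧
        Pairwise (Function.onFun Disjoint C) ∧ volume (B \ ⋃ c, C c) = 0 ∧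
        ∀ c, (∀ x ∈ C c, g x = 0) ∧
          ∃ (R : ℕ) (f : Fin R → Fin (k) → ℤ) (q : Fin R → (Fin n → ℝ) → ℝ),
            (∀ r, IsSemialgebraicFunOn ℚ (C c) (q r)) ∧
            (∀ r, ∀ x ∈ C c, ∏ i, (fun i => W (Fin.castSucc i)) i x ^ (f r i) = 1) ∧
            (∀ i, ∀ x ∈ C c, (fun i => h (Fin.castSucc i)) i x = ∑ r, q r x * (f r i : ℝ))) :
    ∃ (N : ℕ) (C : Fin N → Set (Fin n → ℝ)),
        (∀ c, IsSemialgebraic ℚ (C c) ∧ IsOpen (C c) ∧ C c ⊆ B) ∧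
        Pairwise (Function.onFun Disjoint C) ∧ volume (B \ ⋃ c, C c) = 0 ∧
        ∀ c, (∀ x ∈ C c, g x = 0) ∧
          ∃ (R : ℕ) (f : Fin R → Fin (k + 1) → ℤ) (q : Fin R → (Fin n → ℝ) → ℝ),
            (∀ r, IsSemialgebraicFunOn ℚ (C c) (q r)) ∧
            (∀ r, ∀ x ∈ C c, ∏ i, W i x ^ (f r i) = 1) ∧
            (∀ i, ∀ x ∈ C c, h i x = ∑ r, q r x * (f r i : ℝ)) := by
  obtain ⟨N, C, hC, hdisj, hnull, hcell⟩ := hc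
  refine ⟨N, C, hC, hdisj, hnull, fun c => ⟨(hcell c).1, ?_⟩⟩
  obtain ⟨R, f, q, hq, hfW, hhf⟩ := (hcell c).2
  refine ⟨R, fun r => Fin.snoc (f r) 0, q, hq, fun r x hx => ?_, ?_⟩
  · rw [Fin.prod_univ_castSucc]
    simp only [Fin.snoc_castSucc, Fin.snoc_last, zpow_zero, mul_one]
    exact hfW r x hx
  · refine Fin.lastCases (fun x hx => ?_) (fun i x hx => ?_)
    · simp only [Fin.snoc_last, Int.cast_zero, mul_zero, Finset.sum_const_zero]
      exact h0 x ((hC c).2.2 hx)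
    · simp only [Fin.snoc_castSucc]
      exact hhf i x hx

/-- `Σᵢ fᵢ log wᵢ = log ∏ᵢ wᵢ^{fᵢ}` for positive reals (registered ∀-form of
`descent_sum_int_mul_log`). [folklore] -/
theorem descent_log_prod_zpow : ∀ (k : ℕ) (f : Fin k → ℤ) (w : Fin k → ℝ), (∀ i, 0 < w i) →
    ∑ i, (f i : ℝ) * Real.log (w i) = Real.log (∏ i, w i ^ (f i)) :=
  fun _ f w hw => descent_sum_int_mul_log f w hw

end Summit.KontsevichZagierPeriods.LiouvilleUnfolding.LogPrimitiveNL

end
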